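import Summits.Ventures.PercRepro.RankLevelSetLevelSixArithA
import Summits.Ventures.PercRepro.RankLevelSetLevelFourArith
import Summits.Ventures.PercRepro.RankLevelSetMultFifteenDef
import Summits.Ventures.PercRepro.RankLevelSetTailDoubling

/-!
# PercRepro — PercRepro — THE LEVEL-`6` ARITHMETIC OF THE HEAVY / LIGHT COUNT WITH THE CUBIC MULTIPLICITY, THE DISJOINT PAIR COUNT, THE WINDOWED HEAVY TERM AND THE CIRCUIT TABLES, PART A: `d = 19 … 19`, `p ≥ 23`, THE 25 ROW ON THE CORRECTED CELL (p8 g11, S3) + PercRepro — THE LEVEL-`6` ARITHMETIC OF THE HEAVY / LIGHT COUNT WITH THE CUBIC MULTIPLICITY, THE DISJOINT PAIR COUNT, THE WINDOWED HEAVY TERM AND THE CIRCUIT TABLES, PART A: `d = 8 … 8`, `p ≥ 23`, THE 25 ROW ON THE CORRECTED CELL (p8 g11, S3) (p8 g11, S3)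

Two generated part modules packed into one (`tools/packparts.py`); see the single modules' docstrings in the lane. Axioms: standard.
-/

namespace PercRepro

set_option maxHeartbeats 800000 in
/-- The tail at corank `19`, LEVEL-BY-LEVEL form: `3099·(T₅(n) + U₆(p) + Σ_{j ≤ 19} C(n, j)) ≤ 1000·2^n` for `p ≥ 23`, `n = p + 19`, with `T₅` the level-by-level bound of the rank-`≤ 5` sets (`ncard_eRk_le_five_le_levels`) and `U₆` the heavy / light count of all rank-`6` sets with the windowed heavy term (`ν₁ = 14`, weights to `18`). -/
theorem tail_six_heavy_sq23TN19_19 (p : ℕ) (hp : 23 ≤ p) :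
    ((3099 : ℕ) : ℚ) * (((∑ j ∈ Finset.range (3 + 1), (((p + 19).choose j : ℕ) : ℚ)) +
        (((p + 19).choose 3 : ℚ) +
        ((∑ j ∈ Finset.range (min 6 (3 + 19) - (3 + 1) + 1),
        ((min (3 - 3) (4 - 2)).choose j : ℚ) * (2 / ((Matroid.mult15 (j + 1) : ℕ) : ℚ))) +
        (∑ j ∈ Finset.range (min 6 (3 + 19) - (3 + 1) + 1),
        ((4 - 2).choose j : ℚ) * (2 / ((Matroid.mult15 (j + 1) : ℕ) : ℚ)))) *
        (((81 : ℕ) : ℚ) * ((((p + 19) - 3).choose 1 : ℕ) : ℚ) + ((1287 : ℕ) : ℚ) * ((((p + 19) - 4).choose 0 : ℕ) : ℚ))) +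
        (((p + 19).choose 4 : ℚ) +
        ((∑ j ∈ Finset.range (min 10 (4 + 19) - (4 + 1) + 1),
        ((min (min 6 (3 + 19) - 4) (7 - 2)).choose j : ℚ) * (2 / ((Matroid.mult15 (j + 1) : ℕ) : ℚ))) +
        (∑ j ∈ Finset.range (min 10 (4 + 19) - (4 + 1) + 1),
        ((7 - 2).choose j : ℚ) * (2 / ((Matroid.mult15 (j + 1) : ℕ) : ℚ)))) *
        (((81 : ℕ) : ℚ) * ((((p + 19) - 3).choose 2 : ℕ) : ℚ) + ((1287 : ℕ) : ℚ) * ((((p + 19) - 4).choose 1 : ℕ) : ℚ) +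
        (((19 + 4).choose 5 : ℕ) : ℚ) * ((((p + 19) - 5).choose 0 : ℕ) : ℚ))) +
        (((p + 19).choose 5 : ℚ) +
        ((∑ j ∈ Finset.range (min 19 (5 + 19) - (5 + 1) + 1),
        ((min (min 10 (4 + 19) - 5) (15 - 2)).choose j : ℚ) * (2 / ((Matroid.mult15 (j + 1) : ℕ) : ℚ))) +
        (∑ j ∈ Finset.range (min 19 (5 + 19) - (5 + 1) + 1),
        ((15 - 2).choose j : ℚ) * (2 / ((Matroid.mult15 (j + 1) : ℕ) : ℚ)))) *
        (((81 : ℕ) : ℚ) * ((((p + 19) - 3).choose 3 : ℕ) : ℚ) + ((1287 : ℕ) : ℚ) * ((((p + 19) - 4).choose 2 : ℕ) : ℚ) +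
        (((19 + 4).choose 5 : ℕ) : ℚ) * ((((p + 19) - 5).choose 1 : ℕ) : ℚ) +
        (((19 + 5).choose 6 : ℕ) : ℚ) * ((((p + 19) - 6).choose 0 : ℕ) : ℚ)))) +
      ((((p + 19).choose 6 : ℕ) : ℚ) +
        ((∑ i ∈ Finset.range (min 39 (6 + 19) - 7 + 1), ((Nat.choose (min (min 19 (5 + 19) - 6) (14 - 2)) i : ℕ) : ℚ) * (1 / ((((i + 1) * ((i + 1) ^ 2 + 1) / 2 : ℕ) : ℚ)))) *
          (((81 : ℕ) : ℚ) * ((p + 19 - 3).choose 4 : ℚ) + ((1287 : ℕ) : ℚ) * ((p + 19 - 4).choose 3 : ℚ) + ((19309 : ℕ) : ℚ) * ((p + 19 - 5).choose 2 : ℚ) + (((19 + 5).choose 6 : ℕ) : ℚ) * ((p + 19 - 6 : ℕ) : ℚ) + (((19 + 6).choose 7 : ℕ) : ℚ)) +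
        ((0 : ℕ) : ℚ) * (∑ i ∈ Finset.range (min 39 (6 + 19) - 7 + 1), ((Nat.choose (14 - 2) i : ℕ) : ℚ) * (1 / ((((i + 1) * ((i + 1) ^ 2 + 1) / 2 : ℕ) : ℚ)))) *
          (((81 : ℕ) : ℚ) * ((p + 19 - 3).choose 4 : ℚ) + ((1287 : ℕ) : ℚ) * ((p + 19 - 4).choose 3 : ℚ) + ((19309 : ℕ) : ℚ) * ((p + 19 - 5).choose 2 : ℚ) + (((19 + 5).choose 6 : ℕ) : ℚ) * ((p + 19 - 6 : ℕ) : ℚ) + (((19 + 6).choose 7 : ℕ) : ℚ)) +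
        (∑ i ∈ Finset.Icc 6 (min 39 (6 + 19)), ((Nat.choose 30 i : ℕ) : ℚ)) +
          ((∑ i ∈ Finset.Icc 6 (min 39 (6 + 19)), ((Nat.choose 19 i : ℕ) : ℚ)) +
            ((p + 19 - 19 : ℕ) : ℚ) * (∑ i ∈ Finset.Icc 5 ((min 39 (6 + 19)) - 1), ((Nat.choose 19 i : ℕ) : ℚ))))) +
      (∑ j ∈ Finset.range (19 + 1), (((p + 19).choose j : ℕ) : ℚ))) ≤ ((1000 : ℕ) : ℚ) * 2 ^ (p + 19) := by
  have hT1 : (∑ j ∈ Finset.range (min 6 (3 + 19) - (3 + 1) + 1),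
        ((min (3 - 3) (4 - 2)).choose j : ℚ) * (2 / ((Matroid.mult15 (j + 1) : ℕ) : ℚ))) = (1 : ℚ) := by
    norm_num [Finset.sum_range_succ, Nat.choose, Matroid.mult15]
  have hT2 : (∑ j ∈ Finset.range (min 6 (3 + 19) - (3 + 1) + 1),
        ((4 - 2).choose j : ℚ) * (2 / ((Matroid.mult15 (j + 1) : ℕ) : ℚ))) = (22 / 15 : ℚ) := by
    norm_num [Finset.sum_range_succ, Nat.choose, Matroid.mult15]
  have hT3 : (∑ j ∈ Finset.range (min 10 (4 + 19) - (4 + 1) + 1),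
        ((min (min 6 (3 + 19) - 4) (7 - 2)).choose j : ℚ) * (2 / ((Matroid.mult15 (j + 1) : ℕ) : ℚ))) = (22 / 15 : ℚ) := by
    norm_num [Finset.sum_range_succ, Nat.choose, Matroid.mult15]
  have hT4 : (∑ j ∈ Finset.range (min 10 (4 + 19) - (4 + 1) + 1),
        ((7 - 2).choose j : ℚ) * (2 / ((Matroid.mult15 (j + 1) : ℕ) : ℚ))) = (12895 / 3927 : ℚ) := by
    norm_num [Finset.sum_range_succ, Nat.choose, Matroid.mult15]
  have hT5 : (∑ j ∈ Finset.range (min 19 (5 + 19) - (5 + 1) + 1),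
        ((min (min 10 (4 + 19) - 5) (15 - 2)).choose j : ℚ) * (2 / ((Matroid.mult15 (j + 1) : ℕ) : ℚ))) = (12895 / 3927 : ℚ) := by
    norm_num [Finset.sum_range_succ, Nat.choose, Matroid.mult15]
  have hT6 : (∑ j ∈ Finset.range (min 19 (5 + 19) - (5 + 1) + 1),
        ((15 - 2).choose j : ℚ) * (2 / ((Matroid.mult15 (j + 1) : ℕ) : ℚ))) = (318095969207 / 2473262680 : ℚ) := by
    norm_num [Finset.sum_range_succ, Nat.choose, Matroid.mult15]
  have hσ1 : (∑ i ∈ Finset.range (min 39 (6 + 19) - 7 + 1), ((Nat.choose (min (min 19 (5 + 19) - 6) (14 - 2)) i : ℕ) : ℚ) * (1 / ((((i + 1) * ((i + 1) ^ 2 + 1) / 2 : ℕ) : ℚ)))) = (58758080057566 / 1497500823325 : ℚ) := by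
    norm_num [Finset.sum_range_succ, Nat.choose]
  have hσ2 : (∑ i ∈ Finset.range (min 39 (6 + 19) - 7 + 1), ((Nat.choose (14 - 2) i : ℕ) : ℚ) * (1 / ((((i + 1) * ((i + 1) ^ 2 + 1) / 2 : ℕ) : ℚ)))) = (58758080057566 / 1497500823325 : ℚ) := by
    norm_num [Finset.sum_range_succ, Nat.choose]
  have hs3 : ((81 : ℕ) : ℚ) = (81 : ℚ) := by norm_num
  have hs4 : ((1287 : ℕ) : ℚ) = (1287 : ℚ) := by norm_num
  have hs5 : ((19309 : ℕ) : ℚ) = (19309 : ℚ) := by norm_num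
  have hs5c : (((19 + 4).choose 5 : ℕ) : ℚ) = (33649 : ℚ) := by norm_num [Nat.choose]
  have hs6 : (((19 + 5).choose 6 : ℕ) : ℚ) = (134596 : ℚ) := by norm_num [Nat.choose]
  have hs7 : (((19 + 6).choose 7 : ℕ) : ℚ) = (480700 : ℚ) := by norm_num [Nat.choose]
  have hb : ((0 : ℕ) : ℚ) = (0 : ℚ) := by norm_num
  have hG : (∑ i ∈ Finset.Icc 6 (min 39 (6 + 19)), ((Nat.choose 30 i : ℕ) : ℚ)) = (1073535456 : ℚ) := by
    rw [show Finset.Icc 6 (min 39 (6 + 19)) = Finset.Ico 6 26 from (Finset.Ico_succ_right_eq_Icc 6 25).symm, Finset.sum_Ico_eq_sum_range]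
    norm_num [Finset.sum_range_succ, Nat.choose]
  have hH : (∑ i ∈ Finset.Icc 6 (min 39 (6 + 19)), ((Nat.choose 19 i : ℕ) : ℚ)) = (507624 : ℚ) := by
    rw [show Finset.Icc 6 (min 39 (6 + 19)) = Finset.Ico 6 26 from (Finset.Ico_succ_right_eq_Icc 6 25).symm, Finset.sum_Ico_eq_sum_range]
    norm_num [Finset.sum_range_succ, Nat.choose]
  have hH2 : (∑ i ∈ Finset.Icc 5 ((min 39 (6 + 19)) - 1), ((Nat.choose 19 i : ℕ) : ℚ)) = (519252 : ℚ) := by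
    rw [show Finset.Icc 5 (min 39 (6 + 19) - 1) = Finset.Ico 5 25 from (Finset.Ico_succ_right_eq_Icc 5 24).symm, Finset.sum_Ico_eq_sum_range]
    norm_num [Finset.sum_range_succ, Nat.choose]
  simp only [hT1, hT2, hT3, hT4, hT5, hT6, hσ1, hσ2, hs3, hs4, hs5, hs5c, hs6, hs7, hb, hG, hH, hH2, Nat.choose_zero_right, Nat.choose_one_right, Nat.cast_one, mul_one]
  induction p, hp using Nat.le_induction with
  | base =>
    simp only [Finset.sum_range_succ]
    norm_num [Nat.choose]
  | succ p hp ih =>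
    have hS3 := sum_choose_succ_le_two_mul (p + 19) 3
    have hSd := sum_choose_succ_le_two_mul (p + 19) 19
    have hS3q : (∑ j ∈ Finset.range (3 + 1), (((p + 1 + 19).choose j : ℕ) : ℚ)) ≤
        2 * ∑ j ∈ Finset.range (3 + 1), (((p + 19).choose j : ℕ) : ℚ) := by
      rw [show p + 1 + 19 = p + 19 + 1 by ring]
      exact_mod_cast hS3
    have hSdq : (∑ j ∈ Finset.range (19 + 1), (((p + 1 + 19).choose j : ℕ) : ℚ)) ≤
        2 * ∑ j ∈ Finset.range (19 + 1), (((p + 19).choose j : ℕ) : ℚ) := by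
      rw [show p + 1 + 19 = p + 19 + 1 by ring]
      exact_mod_cast hSd
    have hc0_3 := ThmN.choose_succ_le_two_mul_q (p + 19) 3 (by omega)
    have hc0_4 := ThmN.choose_succ_le_two_mul_q (p + 19) 4 (by omega)
    have hc0_5 := ThmN.choose_succ_le_two_mul_q (p + 19) 5 (by omega)
    have hc0_6 := ThmN.choose_succ_le_two_mul_q (p + 19) 6 (by omega)
    have hc3_2 := ThmN.choose_succ_le_two_mul_q (p + 19 - 3) 2 (by omega)
    have hc3_3 := ThmN.choose_succ_le_two_mul_q (p + 19 - 3) 3 (by omega)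
    have hc3_4 := ThmN.choose_succ_le_two_mul_q (p + 19 - 3) 4 (by omega)
    have hc4_2 := ThmN.choose_succ_le_two_mul_q (p + 19 - 4) 2 (by omega)
    have hc4_3 := ThmN.choose_succ_le_two_mul_q (p + 19 - 4) 3 (by omega)
    have hc5_2 := ThmN.choose_succ_le_two_mul_q (p + 19 - 5) 2 (by omega)
    have hl3 : ((p + 19 + 1 - 3 : ℕ) : ℚ) = ((p + 19 - 3 : ℕ) : ℚ) + 1 := by
      rw [show p + 19 + 1 - 3 = p + 19 - 3 + 1 by omega]; push_cast; ring
    have hl30 : (1 : ℚ) ≤ ((p + 19 - 3 : ℕ) : ℚ) := by exact_mod_cast (show 1 ≤ p + 19 - 3 by omega)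
    have hl4 : ((p + 19 + 1 - 4 : ℕ) : ℚ) = ((p + 19 - 4 : ℕ) : ℚ) + 1 := by
      rw [show p + 19 + 1 - 4 = p + 19 - 4 + 1 by omega]; push_cast; ring
    have hl40 : (1 : ℚ) ≤ ((p + 19 - 4 : ℕ) : ℚ) := by exact_mod_cast (show 1 ≤ p + 19 - 4 by omega)
    have hl5 : ((p + 19 + 1 - 5 : ℕ) : ℚ) = ((p + 19 - 5 : ℕ) : ℚ) + 1 := by
      rw [show p + 19 + 1 - 5 = p + 19 - 5 + 1 by omega]; push_cast; ring
    have hl50 : (1 : ℚ) ≤ ((p + 19 - 5 : ℕ) : ℚ) := by exact_mod_cast (show 1 ≤ p + 19 - 5 by omega)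
    have hl6 : ((p + 19 + 1 - 6 : ℕ) : ℚ) = ((p + 19 - 6 : ℕ) : ℚ) + 1 := by
      rw [show p + 19 + 1 - 6 = p + 19 - 6 + 1 by omega]; push_cast; ring
    have hl60 : (1 : ℚ) ≤ ((p + 19 - 6 : ℕ) : ℚ) := by exact_mod_cast (show 1 ≤ p + 19 - 6 by omega)
    have hlU : ((p + 19 + 1 - 19 : ℕ) : ℚ) = ((p + 19 - 19 : ℕ) : ℚ) + 1 := by
      rw [show p + 19 + 1 - 19 = p + 19 - 19 + 1 by omega]; push_cast; ring
    have hlU0 : (1 : ℚ) ≤ ((p + 19 - 19 : ℕ) : ℚ) := by exact_mod_cast (show 1 ≤ p + 19 - 19 by omega)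
    have hl00 : (1 : ℚ) ≤ ((p + 19 : ℕ) : ℚ) := by exact_mod_cast (show 1 ≤ p + 19 by omega)
    rw [show p + 1 + 19 = p + 19 + 1 by ring] at *
    rw [show p + 19 + 1 - 3 = p + 19 - 3 + 1 by omega, show p + 19 + 1 - 4 = p + 19 - 4 + 1 by omega,
      show p + 19 + 1 - 5 = p + 19 - 5 + 1 by omega, hl6, hlU]
    rw [show (2 : ℚ) ^ (p + 19 + 1) = 2 ^ (p + 19) * 2 from pow_succ _ _]
    push_cast at *
    linarith [hS3q, hSdq, hc0_3, hc0_4, hc0_5, hc0_6, hc3_2, hc3_3, hc3_4, hc4_2, hc4_3, hc5_2, hl30, hl40, hl50, hl60, hlU0, hl00, ih]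

set_option maxHeartbeats 800000 in
/-- `(P_19)` at level `6`, heavy / light count with the CUBIC multiplicity (`ν₁ = 14`, `j = 1`, `j′ = 1`, `uG = 30`, `uH = 19`, `b = 0`, `Kn/Kd = 3099/1000`; `σ₁⁺ = 58758080057566/1497500823325`, `σ₂⁺ = 58758080057566/1497500823325`; `s₃ ≤ cq3`, `s₄`, `s₅` by the tables), for every `p ≥ 23`. -/
theorem level_six_poly_heavy_sq23TN19_19 (p : ℕ) (hp : 23 ≤ p) :
    (3099 : ℚ) * ((((p + 19).choose 6 : ℕ) : ℚ) + (((Nat.choose 81 2 : ℕ) : ℚ) * ((p + 19 - 5 : ℕ) : ℚ) - ((81 : ℕ) : ℚ) * (((p + 19 - 3).choose 3 : ℕ) : ℚ) +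
      ((∑ i ∈ Finset.range (19 - 7 + 1), ((Nat.choose (min (min 19 (5 + 19) - 6) (14 - 2)) i : ℕ) : ℚ) * (1 / ((((i + 1) * ((i + 1) ^ 2 + 1) / 2 : ℕ) : ℚ)))) *
        (((81 : ℕ) : ℚ) * ((p + 19 - 3).choose 4 : ℚ) + ((1287 : ℕ) : ℚ) * ((p + 19 - 4).choose 3 : ℚ) + ((19309 : ℕ) : ℚ) * ((p + 19 - 5).choose 2 : ℚ) + (((19 + 5).choose 6 : ℕ) : ℚ) * ((p + 19 - 6 : ℕ) : ℚ) + (((19 + 6).choose 7 : ℕ) : ℚ)) +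
      ((0 : ℕ) : ℚ) * (∑ i ∈ Finset.range (19 - 7 + 1), ((Nat.choose (14 - 2) i : ℕ) : ℚ) * (1 / ((((i + 1) * ((i + 1) ^ 2 + 1) / 2 : ℕ) : ℚ)))) *
        (((81 : ℕ) : ℚ) * ((p + 19 - 3).choose 4 : ℚ) + ((1287 : ℕ) : ℚ) * ((p + 19 - 4).choose 3 : ℚ) + ((19309 : ℕ) : ℚ) * ((p + 19 - 5).choose 2 : ℚ) + (((19 + 5).choose 6 : ℕ) : ℚ) * ((p + 19 - 6 : ℕ) : ℚ) + (((19 + 6).choose 7 : ℕ) : ℚ)) +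
      (∑ i ∈ Finset.Icc 6 19, ((Nat.choose 30 i : ℕ) : ℚ)) +
          ((∑ i ∈ Finset.Icc 6 19, ((Nat.choose 19 i : ℕ) : ℚ)) +
            ((p + 19 - 19 : ℕ) : ℚ) * (∑ i ∈ Finset.Icc 5 (19 - 1), ((Nat.choose 19 i : ℕ) : ℚ)))))) ≤
      ((3099 - 1000 : ℕ) : ℚ) * 2 ^ (19 - 6) * (((p + 6).choose 6 : ℕ) : ℚ) := by
  have hσ1 : (∑ i ∈ Finset.range (19 - 7 + 1), ((Nat.choose (min (min 19 (5 + 19) - 6) (14 - 2)) i : ℕ) : ℚ) * (1 / ((((i + 1) * ((i + 1) ^ 2 + 1) / 2 : ℕ) : ℚ)))) = (58758080057566 / 1497500823325 : ℚ) := by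
    norm_num [Finset.sum_range_succ, Nat.choose]
  have hσ2 : (∑ i ∈ Finset.range (19 - 7 + 1), ((Nat.choose (14 - 2) i : ℕ) : ℚ) * (1 / ((((i + 1) * ((i + 1) ^ 2 + 1) / 2 : ℕ) : ℚ)))) = (58758080057566 / 1497500823325 : ℚ) := by
    norm_num [Finset.sum_range_succ, Nat.choose]
  have hs3 : ((81 : ℕ) : ℚ) = (81 : ℚ) := by norm_num
  have hs4 : ((1287 : ℕ) : ℚ) = (1287 : ℚ) := by norm_num
  have hs5 : ((19309 : ℕ) : ℚ) = (19309 : ℚ) := by norm_num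
  have hs6 : (((19 + 5).choose 6 : ℕ) : ℚ) = (134596 : ℚ) := by norm_num [Nat.choose]
  have hs7 : (((19 + 6).choose 7 : ℕ) : ℚ) = (480700 : ℚ) := by norm_num [Nat.choose]
  have hK : ((3099 - 1000 : ℕ) : ℚ) = (2099 : ℚ) := by norm_num
  have hb : ((0 : ℕ) : ℚ) = (0 : ℚ) := by norm_num
  have hG : (∑ i ∈ Finset.Icc 6 19, ((Nat.choose 30 i : ℕ) : ℚ)) = (1020558285 : ℚ) := by
    rw [show Finset.Icc 6 19 = Finset.Ico 6 20 from (Finset.Ico_succ_right_eq_Icc 6 19).symm, Finset.sum_Ico_eq_sum_range]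
    norm_num [Finset.sum_range_succ, Nat.choose]
  have hH : (∑ i ∈ Finset.Icc 6 19, ((Nat.choose 19 i : ℕ) : ℚ)) = (507624 : ℚ) := by
    rw [show Finset.Icc 6 19 = Finset.Ico 6 20 from (Finset.Ico_succ_right_eq_Icc 6 19).symm, Finset.sum_Ico_eq_sum_range]
    norm_num [Finset.sum_range_succ, Nat.choose]
  have hH2 : (∑ i ∈ Finset.Icc 5 (19 - 1), ((Nat.choose 19 i : ℕ) : ℚ)) = (519251 : ℚ) := by
    rw [show Finset.Icc 5 (19 - 1) = Finset.Ico 5 19 from (Finset.Ico_succ_right_eq_Icc 5 18).symm, Finset.sum_Ico_eq_sum_range]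
    norm_num [Finset.sum_range_succ, Nat.choose]
  have hc32 : ((Nat.choose 81 2 : ℕ) : ℚ) = (3240 : ℚ) := by rw [Nat.choose_two_right]; norm_num
  rw [hc32]
  simp only [hσ1, hσ2, hs3, hs4, hs5, hs6, hs7, hK, hb, hG, hH, hH2]
  obtain ⟨t, rfl⟩ : ∃ t, p = 23 + t := ⟨p - 23, by omega⟩
  rw [show 23 + t + 19 - 3 = 35 + t + 4 by omega, show 23 + t + 19 - 4 = 35 + t + 3 by omega,
    show 23 + t + 19 - 5 = 35 + t + 2 by omega, show 23 + t + 19 - 6 = 36 + t by omega,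
    show 23 + t + 19 - 19 = 23 + t by omega]
  have h1 : (720 : ℚ) * (((23 + t + 19).choose 6 : ℕ) : ℚ) = ((36 : ℚ) + t + 1) * ((36 : ℚ) + t + 2) * ((36 : ℚ) + t + 3) * ((36 : ℚ) + t + 4) * ((36 : ℚ) + t + 5) * ((36 : ℚ) + t + 6) := by
    have := choose_six_mul (36 + t)
    rw [show 23 + t + 19 = 36 + t + 6 by omega]
    exact_mod_cast this
  have h2 : (6 : ℚ) * (((35 + t + 4).choose 3 : ℕ) : ℚ) = ((35 : ℚ) + 1 + t + 1) * ((35 : ℚ) + 1 + t + 2) * ((35 : ℚ) + t + 4) := by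
    have := choose_three_mul (35 + 1 + t)
    rw [show 35 + 1 + t + 3 = 35 + t + 4 by omega] at this
    exact_mod_cast this
  have h3 : (24 : ℚ) * (((35 + t + 4).choose 4 : ℕ) : ℚ) = ((35 : ℚ) + t + 1) * ((35 : ℚ) + t + 2) * ((35 : ℚ) + t + 3) * ((35 : ℚ) + t + 4) := by
    exact_mod_cast choose_four_mul (35 + t)
  have h4 : (6 : ℚ) * (((35 + t + 3).choose 3 : ℕ) : ℚ) = ((35 : ℚ) + t + 1) * ((35 : ℚ) + t + 2) * ((35 : ℚ) + t + 3) := by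
    exact_mod_cast choose_three_mul (35 + t)
  have h5 : (2 : ℚ) * (((35 + t + 2).choose 2 : ℕ) : ℚ) = ((35 : ℚ) + t + 1) * ((35 : ℚ) + t + 2) := by
    exact_mod_cast choose_two_mul (35 + t)
  have h6 : (720 : ℚ) * (((23 + t + 6).choose 6 : ℕ) : ℚ) = ((23 : ℚ) + t + 1) * ((23 : ℚ) + t + 2) * ((23 : ℚ) + t + 3) * ((23 : ℚ) + t + 4) * ((23 : ℚ) + t + 5) * ((23 : ℚ) + t + 6) := by
    have := choose_six_mul (23 + t)
    exact_mod_cast this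
  push_cast
  nlinarith [h1, h2, h3, h4, h5, h6, pow_nonneg (Nat.cast_nonneg t : (0 : ℚ) ≤ t) 1, pow_nonneg (Nat.cast_nonneg t : (0 : ℚ) ≤ t) 2, pow_nonneg (Nat.cast_nonneg t : (0 : ℚ) ≤ t) 3, pow_nonneg (Nat.cast_nonneg t : (0 : ℚ) ≤ t) 4, pow_nonneg (Nat.cast_nonneg t : (0 : ℚ) ≤ t) 5, pow_nonneg (Nat.cast_nonneg t : (0 : ℚ) ≤ t) 6]

/-- The tail at corank `8`, LEVEL-BY-LEVEL form: `92052·(T₅(n) + U₆(p) + Σ_{j ≤ 8} C(n, j)) ≤ 1000·2^n` for `p ≥ 23`, `n = p + 8`, with `T₅` the level-by-level bound of the rank-`≤ 5` sets (`ncard_eRk_le_five_le_levels`) and `U₆` the heavy / light count of all rank-`6` sets with the windowed heavy term (`ν₁ = 7`, weights to `7`). -/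
theorem tail_six_heavy_sq23TZ8_8 (p : ℕ) (hp : 23 ≤ p) :
    ((92052 : ℕ) : ℚ) * (((∑ j ∈ Finset.range (3 + 1), (((p + 8).choose j : ℕ) : ℚ)) +
        (((p + 8).choose 3 : ℚ) +
        ((∑ j ∈ Finset.range (min 6 (3 + 8) - (3 + 1) + 1),
        ((min (3 - 3) (4 - 2)).choose j : ℚ) * (2 / ((Matroid.mult15 (j + 1) : ℕ) : ℚ))) +
        (∑ j ∈ Finset.range (min 6 (3 + 8) - (3 + 1) + 1),
        ((4 - 2).choose j : ℚ) * (2 / ((Matroid.mult15 (j + 1) : ℕ) : ℚ)))) *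
        (((11 : ℕ) : ℚ) * ((((p + 8) - 3).choose 1 : ℕ) : ℚ) + ((62 : ℕ) : ℚ) * ((((p + 8) - 4).choose 0 : ℕ) : ℚ))) +
        (((p + 8).choose 4 : ℚ) +
        ((∑ j ∈ Finset.range (min 10 (4 + 8) - (4 + 1) + 1),
        ((min (min 6 (3 + 8) - 4) (7 - 2)).choose j : ℚ) * (2 / ((Matroid.mult15 (j + 1) : ℕ) : ℚ))) +
        (∑ j ∈ Finset.range (min 10 (4 + 8) - (4 + 1) + 1),
        ((7 - 2).choose j : ℚ) * (2 / ((Matroid.mult15 (j + 1) : ℕ) : ℚ)))) *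
        (((11 : ℕ) : ℚ) * ((((p + 8) - 3).choose 2 : ℕ) : ℚ) + ((62 : ℕ) : ℚ) * ((((p + 8) - 4).choose 1 : ℕ) : ℚ) +
        (((8 + 4).choose 5 : ℕ) : ℚ) * ((((p + 8) - 5).choose 0 : ℕ) : ℚ))) +
        (((p + 8).choose 5 : ℚ) +
        ((∑ j ∈ Finset.range (min 19 (5 + 8) - (5 + 1) + 1),
        ((min (min 10 (4 + 8) - 5) (15 - 2)).choose j : ℚ) * (2 / ((Matroid.mult15 (j + 1) : ℕ) : ℚ))) +
        (∑ j ∈ Finset.range (min 19 (5 + 8) - (5 + 1) + 1),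
        ((15 - 2).choose j : ℚ) * (2 / ((Matroid.mult15 (j + 1) : ℕ) : ℚ)))) *
        (((11 : ℕ) : ℚ) * ((((p + 8) - 3).choose 3 : ℕ) : ℚ) + ((62 : ℕ) : ℚ) * ((((p + 8) - 4).choose 2 : ℕ) : ℚ) +
        (((8 + 4).choose 5 : ℕ) : ℚ) * ((((p + 8) - 5).choose 1 : ℕ) : ℚ) +
        (((8 + 5).choose 6 : ℕ) : ℚ) * ((((p + 8) - 6).choose 0 : ℕ) : ℚ)))) +
      ((((p + 8).choose 6 : ℕ) : ℚ) +
        ((∑ i ∈ Finset.range (min 39 (6 + 8) - 7 + 1), ((Nat.choose (min (min 19 (5 + 8) - 6) (7 - 2)) i : ℕ) : ℚ) * (1 / ((((i + 1) * ((i + 1) ^ 2 + 1) / 2 : ℕ) : ℚ)))) *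
          (((11 : ℕ) : ℚ) * ((p + 8 - 3).choose 4 : ℚ) + ((62 : ℕ) : ℚ) * ((p + 8 - 4).choose 3 : ℚ) + ((429 : ℕ) : ℚ) * ((p + 8 - 5).choose 2 : ℚ) + ((1145 : ℕ) : ℚ) * ((p + 8 - 6 : ℕ) : ℚ) + ((2216 : ℕ) : ℚ)) +
        ((0 : ℕ) : ℚ) * (∑ i ∈ Finset.range (min 39 (6 + 8) - 7 + 1), ((Nat.choose (7 - 2) i : ℕ) : ℚ) * (1 / ((((i + 1) * ((i + 1) ^ 2 + 1) / 2 : ℕ) : ℚ)))) *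
          (((11 : ℕ) : ℚ) * ((p + 8 - 3).choose 4 : ℚ) + ((62 : ℕ) : ℚ) * ((p + 8 - 4).choose 3 : ℚ) + ((429 : ℕ) : ℚ) * ((p + 8 - 5).choose 2 : ℚ) + ((1145 : ℕ) : ℚ) * ((p + 8 - 6 : ℕ) : ℚ) + ((2216 : ℕ) : ℚ)) +
        (∑ i ∈ Finset.Icc 6 (min 39 (6 + 8)), ((Nat.choose 13 i : ℕ) : ℚ)) +
          ((∑ i ∈ Finset.Icc 6 (min 39 (6 + 8)), ((Nat.choose 0 i : ℕ) : ℚ)) +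
            ((p + 8 : ℕ) : ℚ) * (∑ i ∈ Finset.Icc 5 ((min 39 (6 + 8)) - 1), ((Nat.choose 0 i : ℕ) : ℚ))))) +
      (∑ j ∈ Finset.range (8 + 1), (((p + 8).choose j : ℕ) : ℚ))) ≤ ((1000 : ℕ) : ℚ) * 2 ^ (p + 8) := by
  have hT1 : (∑ j ∈ Finset.range (min 6 (3 + 8) - (3 + 1) + 1),
        ((min (3 - 3) (4 - 2)).choose j : ℚ) * (2 / ((Matroid.mult15 (j + 1) : ℕ) : ℚ))) = (1 : ℚ) := by
    norm_num [Finset.sum_range_succ, Nat.choose, Matroid.mult15]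
  have hT2 : (∑ j ∈ Finset.range (min 6 (3 + 8) - (3 + 1) + 1),
        ((4 - 2).choose j : ℚ) * (2 / ((Matroid.mult15 (j + 1) : ℕ) : ℚ))) = (22 / 15 : ℚ) := by
    norm_num [Finset.sum_range_succ, Nat.choose, Matroid.mult15]
  have hT3 : (∑ j ∈ Finset.range (min 10 (4 + 8) - (4 + 1) + 1),
        ((min (min 6 (3 + 8) - 4) (7 - 2)).choose j : ℚ) * (2 / ((Matroid.mult15 (j + 1) : ℕ) : ℚ))) = (22 / 15 : ℚ) := by
    norm_num [Finset.sum_range_succ, Nat.choose, Matroid.mult15]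
  have hT4 : (∑ j ∈ Finset.range (min 10 (4 + 8) - (4 + 1) + 1),
        ((7 - 2).choose j : ℚ) * (2 / ((Matroid.mult15 (j + 1) : ℕ) : ℚ))) = (12895 / 3927 : ℚ) := by
    norm_num [Finset.sum_range_succ, Nat.choose, Matroid.mult15]
  have hT5 : (∑ j ∈ Finset.range (min 19 (5 + 8) - (5 + 1) + 1),
        ((min (min 10 (4 + 8) - 5) (15 - 2)).choose j : ℚ) * (2 / ((Matroid.mult15 (j + 1) : ℕ) : ℚ))) = (12895 / 3927 : ℚ) := by
    norm_num [Finset.sum_range_succ, Nat.choose, Matroid.mult15]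
  have hT6 : (∑ j ∈ Finset.range (min 19 (5 + 8) - (5 + 1) + 1),
        ((15 - 2).choose j : ℚ) * (2 / ((Matroid.mult15 (j + 1) : ℕ) : ℚ))) = (1513976 / 13685 : ℚ) := by
    norm_num [Finset.sum_range_succ, Nat.choose, Matroid.mult15]
  have hσ1 : (∑ i ∈ Finset.range (min 39 (6 + 8) - 7 + 1), ((Nat.choose (min (min 19 (5 + 8) - 6) (7 - 2)) i : ℕ) : ℚ) * (1 / ((((i + 1) * ((i + 1) ^ 2 + 1) / 2 : ℕ) : ℚ)))) = (24913 / 8177 : ℚ) := by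
    norm_num [Finset.sum_range_succ, Nat.choose]
  have hσ2 : (∑ i ∈ Finset.range (min 39 (6 + 8) - 7 + 1), ((Nat.choose (7 - 2) i : ℕ) : ℚ) * (1 / ((((i + 1) * ((i + 1) ^ 2 + 1) / 2 : ℕ) : ℚ)))) = (24913 / 8177 : ℚ) := by
    norm_num [Finset.sum_range_succ, Nat.choose]
  have hs3 : ((11 : ℕ) : ℚ) = (11 : ℚ) := by norm_num
  have hs4 : ((62 : ℕ) : ℚ) = (62 : ℚ) := by norm_num
  have hs5 : ((429 : ℕ) : ℚ) = (429 : ℚ) := by norm_num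
  have hs5c : (((8 + 4).choose 5 : ℕ) : ℚ) = (792 : ℚ) := by norm_num [Nat.choose]
  have hs6 : ((1145 : ℕ) : ℚ) = (1145 : ℚ) := by norm_num
  have hs7 : ((2216 : ℕ) : ℚ) = (2216 : ℚ) := by norm_num
  have hb : ((0 : ℕ) : ℚ) = (0 : ℚ) := by norm_num
  have hG : (∑ i ∈ Finset.Icc 6 (min 39 (6 + 8)), ((Nat.choose 13 i : ℕ) : ℚ)) = (5812 : ℚ) := by
    rw [show Finset.Icc 6 (min 39 (6 + 8)) = Finset.Ico 6 15 from (Finset.Ico_succ_right_eq_Icc 6 14).symm, Finset.sum_Ico_eq_sum_range]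
    norm_num [Finset.sum_range_succ, Nat.choose]
  have hH : (∑ i ∈ Finset.Icc 6 (min 39 (6 + 8)), ((Nat.choose 0 i : ℕ) : ℚ)) = (0 : ℚ) := by
    rw [show Finset.Icc 6 (min 39 (6 + 8)) = Finset.Ico 6 15 from (Finset.Ico_succ_right_eq_Icc 6 14).symm, Finset.sum_Ico_eq_sum_range]
    norm_num [Finset.sum_range_succ, Nat.choose]
  have hH2 : (∑ i ∈ Finset.Icc 5 ((min 39 (6 + 8)) - 1), ((Nat.choose 0 i : ℕ) : ℚ)) = (0 : ℚ) := by
    rw [show Finset.Icc 5 (min 39 (6 + 8) - 1) = Finset.Ico 5 14 from (Finset.Ico_succ_right_eq_Icc 5 13).symm, Finset.sum_Ico_eq_sum_range]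
    norm_num [Finset.sum_range_succ, Nat.choose]
  simp only [hT1, hT2, hT3, hT4, hT5, hT6, hσ1, hσ2, hs3, hs4, hs5, hs5c, hs6, hs7, hb, hG, hH, hH2, Nat.choose_zero_right, Nat.choose_one_right, Nat.cast_one, mul_one]
  induction p, hp using Nat.le_induction with
  | base =>
    simp only [Finset.sum_range_succ]
    norm_num [Nat.choose]
  | succ p hp ih =>
    have hS3 := sum_choose_succ_le_two_mul (p + 8) 3
    have hSd := sum_choose_succ_le_two_mul (p + 8) 8
    have hS3q : (∑ j ∈ Finset.range (3 + 1), (((p + 1 + 8).choose j : ℕ) : ℚ)) ≤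
        2 * ∑ j ∈ Finset.range (3 + 1), (((p + 8).choose j : ℕ) : ℚ) := by
      rw [show p + 1 + 8 = p + 8 + 1 by ring]
      exact_mod_cast hS3
    have hSdq : (∑ j ∈ Finset.range (8 + 1), (((p + 1 + 8).choose j : ℕ) : ℚ)) ≤
        2 * ∑ j ∈ Finset.range (8 + 1), (((p + 8).choose j : ℕ) : ℚ) := by
      rw [show p + 1 + 8 = p + 8 + 1 by ring]
      exact_mod_cast hSd
    have hc0_3 := ThmN.choose_succ_le_two_mul_q (p + 8) 3 (by omega)
    have hc0_4 := ThmN.choose_succ_le_two_mul_q (p + 8) 4 (by omega)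
    have hc0_5 := ThmN.choose_succ_le_two_mul_q (p + 8) 5 (by omega)
    have hc0_6 := ThmN.choose_succ_le_two_mul_q (p + 8) 6 (by omega)
    have hc3_2 := ThmN.choose_succ_le_two_mul_q (p + 8 - 3) 2 (by omega)
    have hc3_3 := ThmN.choose_succ_le_two_mul_q (p + 8 - 3) 3 (by omega)
    have hc3_4 := ThmN.choose_succ_le_two_mul_q (p + 8 - 3) 4 (by omega)
    have hc4_2 := ThmN.choose_succ_le_two_mul_q (p + 8 - 4) 2 (by omega)
    have hc4_3 := ThmN.choose_succ_le_two_mul_q (p + 8 - 4) 3 (by omega)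
    have hc5_2 := ThmN.choose_succ_le_two_mul_q (p + 8 - 5) 2 (by omega)
    have hl3 : ((p + 8 + 1 - 3 : ℕ) : ℚ) = ((p + 8 - 3 : ℕ) : ℚ) + 1 := by
      rw [show p + 8 + 1 - 3 = p + 8 - 3 + 1 by omega]; push_cast; ring
    have hl30 : (1 : ℚ) ≤ ((p + 8 - 3 : ℕ) : ℚ) := by exact_mod_cast (show 1 ≤ p + 8 - 3 by omega)
    have hl4 : ((p + 8 + 1 - 4 : ℕ) : ℚ) = ((p + 8 - 4 : ℕ) : ℚ) + 1 := by
      rw [show p + 8 + 1 - 4 = p + 8 - 4 + 1 by omega]; push_cast; ring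
    have hl40 : (1 : ℚ) ≤ ((p + 8 - 4 : ℕ) : ℚ) := by exact_mod_cast (show 1 ≤ p + 8 - 4 by omega)
    have hl5 : ((p + 8 + 1 - 5 : ℕ) : ℚ) = ((p + 8 - 5 : ℕ) : ℚ) + 1 := by
      rw [show p + 8 + 1 - 5 = p + 8 - 5 + 1 by omega]; push_cast; ring
    have hl50 : (1 : ℚ) ≤ ((p + 8 - 5 : ℕ) : ℚ) := by exact_mod_cast (show 1 ≤ p + 8 - 5 by omega)
    have hl6 : ((p + 8 + 1 - 6 : ℕ) : ℚ) = ((p + 8 - 6 : ℕ) : ℚ) + 1 := by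
      rw [show p + 8 + 1 - 6 = p + 8 - 6 + 1 by omega]; push_cast; ring
    have hl60 : (1 : ℚ) ≤ ((p + 8 - 6 : ℕ) : ℚ) := by exact_mod_cast (show 1 ≤ p + 8 - 6 by omega)
    have hl00 : (1 : ℚ) ≤ ((p + 8 : ℕ) : ℚ) := by exact_mod_cast (show 1 ≤ p + 8 by omega)
    rw [show p + 1 + 8 = p + 8 + 1 by ring] at *
    rw [show p + 8 + 1 - 3 = p + 8 - 3 + 1 by omega, show p + 8 + 1 - 4 = p + 8 - 4 + 1 by omega,
      show p + 8 + 1 - 5 = p + 8 - 5 + 1 by omega, hl6]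
    rw [show (2 : ℚ) ^ (p + 8 + 1) = 2 ^ (p + 8) * 2 from pow_succ _ _]
    push_cast at *
    linarith [hS3q, hSdq, hc0_3, hc0_4, hc0_5, hc0_6, hc3_2, hc3_3, hc3_4, hc4_2, hc4_3, hc5_2, hl30, hl40, hl50, hl60, hl00, ih]

/-- `(P_8)` at level `6`, heavy / light count with the CUBIC multiplicity (`ν₁ = 7`, `j = 2`, `j′ = 1`, `uG = 13`, `uH = 0`, `b = 0`, `Kn/Kd = 92052/1000`; `σ₁⁺ = 2`, `σ₂⁺ = 2`; `s₃ ≤ cq3`, `s₄`, `s₅` by the tables), for every `p ≥ 23`. -/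
theorem level_six_poly_heavy_sq23TZ8_8 (p : ℕ) (hp : 23 ≤ p) :
    (92052 : ℚ) * ((((p + 8).choose 6 : ℕ) : ℚ) + (((Nat.choose 11 2 : ℕ) : ℚ) * ((p + 8 - 5 : ℕ) : ℚ) - ((11 : ℕ) : ℚ) * (((p + 8 - 3).choose 3 : ℕ) : ℚ) +
      ((∑ i ∈ Finset.range (8 - 7 + 1), ((Nat.choose (min (min 19 (5 + 8) - 6) (7 - 2)) i : ℕ) : ℚ) * (1 / ((((i + 1) * ((i + 1) ^ 2 + 1) / 2 : ℕ) : ℚ)))) *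
        (((11 : ℕ) : ℚ) * ((p + 8 - 3).choose 4 : ℚ) + ((62 : ℕ) : ℚ) * ((p + 8 - 4).choose 3 : ℚ) + ((429 : ℕ) : ℚ) * ((p + 8 - 5).choose 2 : ℚ) + ((1145 : ℕ) : ℚ) * ((p + 8 - 6 : ℕ) : ℚ) + ((2216 : ℕ) : ℚ)) +
      ((0 : ℕ) : ℚ) * (∑ i ∈ Finset.range (8 - 7 + 1), ((Nat.choose (7 - 2) i : ℕ) : ℚ) * (1 / ((((i + 1) * ((i + 1) ^ 2 + 1) / 2 : ℕ) : ℚ)))) *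
        (((11 : ℕ) : ℚ) * ((p + 8 - 3).choose 4 : ℚ) + ((62 : ℕ) : ℚ) * ((p + 8 - 4).choose 3 : ℚ) + ((429 : ℕ) : ℚ) * ((p + 8 - 5).choose 2 : ℚ) + ((1145 : ℕ) : ℚ) * ((p + 8 - 6 : ℕ) : ℚ) + ((2216 : ℕ) : ℚ)) +
      (∑ i ∈ Finset.Icc 6 8, ((Nat.choose 13 i : ℕ) : ℚ)) +
          ((∑ i ∈ Finset.Icc 6 8, ((Nat.choose 0 i : ℕ) : ℚ)) +
            ((p + 8 : ℕ) : ℚ) * (∑ i ∈ Finset.Icc 5 (8 - 1), ((Nat.choose 0 i : ℕ) : ℚ)))))) ≤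
      ((92052 - 1000 : ℕ) : ℚ) * 2 ^ (8 - 6) * (((p + 6).choose 6 : ℕ) : ℚ) := by
  have hσ1 : (∑ i ∈ Finset.range (8 - 7 + 1), ((Nat.choose (min (min 19 (5 + 8) - 6) (7 - 2)) i : ℕ) : ℚ) * (1 / ((((i + 1) * ((i + 1) ^ 2 + 1) / 2 : ℕ) : ℚ)))) = (2 : ℚ) := by
    norm_num [Finset.sum_range_succ, Nat.choose]
  have hσ2 : (∑ i ∈ Finset.range (8 - 7 + 1), ((Nat.choose (7 - 2) i : ℕ) : ℚ) * (1 / ((((i + 1) * ((i + 1) ^ 2 + 1) / 2 : ℕ) : ℚ)))) = (2 : ℚ) := by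
    norm_num [Finset.sum_range_succ, Nat.choose]
  have hs3 : ((11 : ℕ) : ℚ) = (11 : ℚ) := by norm_num
  have hs4 : ((62 : ℕ) : ℚ) = (62 : ℚ) := by norm_num
  have hs5 : ((429 : ℕ) : ℚ) = (429 : ℚ) := by norm_num
  have hs6 : ((1145 : ℕ) : ℚ) = (1145 : ℚ) := by norm_num
  have hs7 : ((2216 : ℕ) : ℚ) = (2216 : ℚ) := by norm_num
  have hK : ((92052 - 1000 : ℕ) : ℚ) = (91052 : ℚ) := by norm_num
  have hb : ((0 : ℕ) : ℚ) = (0 : ℚ) := by norm_num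
  have hG : (∑ i ∈ Finset.Icc 6 8, ((Nat.choose 13 i : ℕ) : ℚ)) = (4719 : ℚ) := by
    rw [show Finset.Icc 6 8 = Finset.Ico 6 9 from (Finset.Ico_succ_right_eq_Icc 6 8).symm, Finset.sum_Ico_eq_sum_range]
    norm_num [Finset.sum_range_succ, Nat.choose]
  have hH : (∑ i ∈ Finset.Icc 6 8, ((Nat.choose 0 i : ℕ) : ℚ)) = (0 : ℚ) := by
    rw [show Finset.Icc 6 8 = Finset.Ico 6 9 from (Finset.Ico_succ_right_eq_Icc 6 8).symm, Finset.sum_Ico_eq_sum_range]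
    norm_num [Finset.sum_range_succ, Nat.choose]
  have hH2 : (∑ i ∈ Finset.Icc 5 (8 - 1), ((Nat.choose 0 i : ℕ) : ℚ)) = (0 : ℚ) := by
    rw [show Finset.Icc 5 (8 - 1) = Finset.Ico 5 8 from (Finset.Ico_succ_right_eq_Icc 5 7).symm, Finset.sum_Ico_eq_sum_range]
    norm_num [Finset.sum_range_succ, Nat.choose]
  have hc32 : ((Nat.choose 11 2 : ℕ) : ℚ) = (55 : ℚ) := by rw [Nat.choose_two_right]; norm_num
  rw [hc32]
  simp only [hσ1, hσ2, hs3, hs4, hs5, hs6, hs7, hK, hb, hG, hH, hH2]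
  obtain ⟨t, rfl⟩ : ∃ t, p = 23 + t := ⟨p - 23, by omega⟩
  rw [show 23 + t + 8 - 3 = 24 + t + 4 by omega, show 23 + t + 8 - 4 = 24 + t + 3 by omega,
    show 23 + t + 8 - 5 = 24 + t + 2 by omega, show 23 + t + 8 - 6 = 25 + t by omega]
  have h1 : (720 : ℚ) * (((23 + t + 8).choose 6 : ℕ) : ℚ) = ((25 : ℚ) + t + 1) * ((25 : ℚ) + t + 2) * ((25 : ℚ) + t + 3) * ((25 : ℚ) + t + 4) * ((25 : ℚ) + t + 5) * ((25 : ℚ) + t + 6) := by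
    have := choose_six_mul (25 + t)
    rw [show 23 + t + 8 = 25 + t + 6 by omega]
    exact_mod_cast this
  have h2 : (6 : ℚ) * (((24 + t + 4).choose 3 : ℕ) : ℚ) = ((24 : ℚ) + 1 + t + 1) * ((24 : ℚ) + 1 + t + 2) * ((24 : ℚ) + t + 4) := by
    have := choose_three_mul (24 + 1 + t)
    rw [show 24 + 1 + t + 3 = 24 + t + 4 by omega] at this
    exact_mod_cast this
  have h3 : (24 : ℚ) * (((24 + t + 4).choose 4 : ℕ) : ℚ) = ((24 : ℚ) + t + 1) * ((24 : ℚ) + t + 2) * ((24 : ℚ) + t + 3) * ((24 : ℚ) + t + 4) := by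
    exact_mod_cast choose_four_mul (24 + t)
  have h4 : (6 : ℚ) * (((24 + t + 3).choose 3 : ℕ) : ℚ) = ((24 : ℚ) + t + 1) * ((24 : ℚ) + t + 2) * ((24 : ℚ) + t + 3) := by
    exact_mod_cast choose_three_mul (24 + t)
  have h5 : (2 : ℚ) * (((24 + t + 2).choose 2 : ℕ) : ℚ) = ((24 : ℚ) + t + 1) * ((24 : ℚ) + t + 2) := by
    exact_mod_cast choose_two_mul (24 + t)
  have h6 : (720 : ℚ) * (((23 + t + 6).choose 6 : ℕ) : ℚ) = ((23 : ℚ) + t + 1) * ((23 : ℚ) + t + 2) * ((23 : ℚ) + t + 3) * ((23 : ℚ) + t + 4) * ((23 : ℚ) + t + 5) * ((23 : ℚ) + t + 6) := by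
    have := choose_six_mul (23 + t)
    exact_mod_cast this
  push_cast
  nlinarith [h1, h2, h3, h4, h5, h6, pow_nonneg (Nat.cast_nonneg t : (0 : ℚ) ≤ t) 1, pow_nonneg (Nat.cast_nonneg t : (0 : ℚ) ≤ t) 2, pow_nonneg (Nat.cast_nonneg t : (0 : ℚ) ≤ t) 3, pow_nonneg (Nat.cast_nonneg t : (0 : ℚ) ≤ t) 4, pow_nonneg (Nat.cast_nonneg t : (0 : ℚ) ≤ t) 5, pow_nonneg (Nat.cast_nonneg t : (0 : ℚ) ≤ t) 6]

end PercRepro
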